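import Mathlib.Analysis.Calculus.FDeriv.Bilinear
import Mathlib.Analysis.Calculus.FDeriv.Add
import Mathlib.Analysis.Calculus.FDeriv.Linear
import Literature.Analysis.Calculus.NewtonKantorovichExactInverse
import HarnessLib

/-!
# Quadratic maps `G u = g₀ + A u + Q u u`: derivative, Lipschitz constant of the derivative, Newton–Kantorovich

`Literature/Analysis/Calculus`, corollary file of `NewtonKantorovichExactInverse.lean` (everything proved; no definitions, no named
facts).  For a map of the form `G u = g₀ + A u + Q u u` on a real normed space `X` with values in `Y` — `A : X →L Y` bounded linear,
`Q : X →L X →L Y` bounded bilinear (not necessarily symmetric) — the two analytic hypotheses of every Newton–Kantorovich statement are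
AUTOMATIC and carry explicit constants:

* `hasFDerivAt_quadraticMap` — `G` is Fréchet differentiable everywhere with `DG(u) = A + Q u + Q.flip u`
  (`v ↦ A v + Q u v + Q v u`; Mathlib's chain rule for bounded bilinear maps `ContinuousLinearMap.hasFDerivAt_of_bilinear`);
* `norm_fderiv_quadraticMap_sub_le` — `‖DG(x) − DG(y)‖ ≤ 2M‖x − y‖` whenever `‖Q u v‖ ≤ M‖u‖‖v‖` (the derivative is AFFINE in `u`;
  its Lipschitz constant is the norm of the symmetrised bilinear form, globally);
* `existsUnique_zero_of_kantorovich_quadratic` — hence, with `Φ = DG(x̄)` boundedly invertible, `‖Φ⁻¹‖ ≤ K`, `‖G x̄‖ ≤ η` and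
  `2K²(2M)η < 1`: exactly one zero in the closed ball of radius `(1 − √(1 − 2K²(2M)η))/(2MK)` about `x̄`
  (`existsUnique_zero_of_kantorovich`), and in every closed ball of radius `< 1/(2MK)` (`…_window`).

Classical (the Newton–Kantorovich theorem for quadratic operators, e.g. Riccati / Navier–Stokes-type steady problems); the constants are
those of [Deuflhard2011] §2.1.1 Thm. 2.1 with `ω̄₀ ≤ K·2M`.  MOTIVATION (recorded for provenance): hypotheses (h1) «global Lipschitz
bound of `DG`» and (h2) «`HasFDerivAt` everywhere» of the kernel chain `CoerciveFiniteRankNewtonKantorovich` /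
`CertificateViscousSheetRChain.existsUnique_zero_of_row` (cell ns-blowup, case Z3-SR-CERT, profile-refuter K-READ (D-0074) items (h1)/(h2)):
the sheet profile map `G(Ω) = Ω + ½ξΩ′ − Ω″ + (a𝒰_Ω Ω′ − (HΩ)Ω)` is `A Ω + Q Ω Ω` with `Q u v = a𝒰_u v′ − (Hu)·v`, and the printed
`L_lip = 2[4√2/L + 4a(π/(4L))^{1/2}]` is `2M` for the bilinear bound `M = 2[2√2/L + 2a(π/(4L))^{1/2}]` of `Q : E × E → X*`.
WHAT THIS IS NOT: nothing about Navier–Stokes.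
-/

noncomputable section

open Metric Set

namespace Literature.Analysis.Calculus

variable {X Y : Type*} [NormedAddCommGroup X] [NormedSpace ℝ X] [NormedAddCommGroup Y] [NormedSpace ℝ Y]

/-- **Derivative of a quadratic map.**  `u ↦ g₀ + A u + Q u u` has Fréchet derivative `A + Q u + Q.flip u`
(`v ↦ A v + Q u v + Q v u`) at every `u`. [cite: Deuflhard2011, §2.1.1 (Newton's method requires `F'`; bilinear chain rule)] -/
theorem hasFDerivAt_quadraticMap (g₀ : Y) (A : X →L[ℝ] Y) (Q : X →L[ℝ] X →L[ℝ] Y) (u : X) :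
    HasFDerivAt (fun v : X => g₀ + A v + Q v v) (A + Q u + Q.flip u) u := by
  have hid : HasFDerivAt (fun v : X => v) (ContinuousLinearMap.id ℝ X) u := hasFDerivAt_id u
  have hQ := Q.hasFDerivAt_of_bilinear hid hid
  have hA : HasFDerivAt (fun v : X => g₀ + A v) A u := by
    simpa using (A.hasFDerivAt (x := u)).const_add g₀
  have h := hA.add hQ
  refine h.congr_fderiv ?_
  ext v
  simp [ContinuousLinearMap.precompR_apply, ContinuousLinearMap.precompL_apply, add_assoc]

/-- The derivative family of a quadratic map, as a function. [cite: Deuflhard2011, §2.1.1 (Newton's method requires `F'`)] -/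
theorem hasFDerivAt_quadraticMap' (g₀ : Y) (A : X →L[ℝ] Y) (Q : X →L[ℝ] X →L[ℝ] Y) :
    ∀ u : X, HasFDerivAt (fun v : X => g₀ + A v + Q v v) ((fun w : X => A + Q w + Q.flip w) u) u :=
  fun u => hasFDerivAt_quadraticMap g₀ A Q u

/-- **Lipschitz constant of the derivative of a quadratic map.**  If `‖Q u v‖ ≤ M‖u‖‖v‖` then
`‖DG(x) − DG(y)‖ ≤ 2M‖x − y‖` for `DG(w) = A + Q w + Q.flip w` (all `x, y`).
[cite: Deuflhard2011, §2.1.1 Thm. 2.1 hypothesis (2.2) (affine covariant Lipschitz condition), here in non-covariant form] -/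
theorem norm_fderiv_quadraticMap_sub_le (A : X →L[ℝ] Y) (Q : X →L[ℝ] X →L[ℝ] Y) {M : ℝ} (hM0 : 0 ≤ M)
    (hM : ∀ u v, ‖Q u v‖ ≤ M * ‖u‖ * ‖v‖) (x y : X) :
    ‖(A + Q x + Q.flip x) - (A + Q y + Q.flip y)‖ ≤ 2 * M * ‖x - y‖ := by
  have heq : (A + Q x + Q.flip x) - (A + Q y + Q.flip y) = Q (x - y) + Q.flip (x - y) := by
    rw [map_sub, map_sub]; abel
  rw [heq]
  refine ContinuousLinearMap.opNorm_le_bound _ (by positivity) fun v => ?_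
  calc ‖(Q (x - y) + Q.flip (x - y)) v‖ = ‖Q (x - y) v + Q v (x - y)‖ := by
        rw [add_apply, ContinuousLinearMap.flip_apply]
    _ ≤ ‖Q (x - y) v‖ + ‖Q v (x - y)‖ := norm_add_le _ _
    _ ≤ M * ‖x - y‖ * ‖v‖ + M * ‖v‖ * ‖x - y‖ := add_le_add (hM _ _) (hM _ _)
    _ = 2 * M * ‖x - y‖ * ‖v‖ := by ring

/-- **Newton–Kantorovich for a quadratic map** `G u = g₀ + A u + Q u u`: with `Φ = DG(x̄) = A + Q x̄ + Q.flip x̄` a continuous linear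
equivalence, `‖Φ⁻¹‖ ≤ K`, `‖Q u v‖ ≤ M‖u‖‖v‖` (`K, M > 0`), `‖G x̄‖ ≤ η` and `2K²(2M)η < 1`, the closed ball of radius
`(1 − √(1 − 2K²(2M)η))/(K·2M)` about `x̄` contains exactly one zero of `G`.
[cite: Deuflhard2011, §2.1.1 Thm. 2.1 (with `α ≤ Kη`, `ω̄₀ ≤ 2MK`)] -/
theorem existsUnique_zero_of_kantorovich_quadratic [CompleteSpace X] (g₀ : Y) (A : X →L[ℝ] Y)
    (Q : X →L[ℝ] X →L[ℝ] Y) (xbar : X) (Φ : X ≃L[ℝ] Y) (hΦ : (Φ : X →L[ℝ] Y) = A + Q xbar + Q.flip xbar)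
    {K M η : ℝ} (hK : ‖(Φ.symm : Y →L[ℝ] X)‖ ≤ K) (hM : ∀ u v, ‖Q u v‖ ≤ M * ‖u‖ * ‖v‖)
    (hη : ‖g₀ + A xbar + Q xbar xbar‖ ≤ η) (hKpos : 0 < K) (hMpos : 0 < M)
    (h : 2 * (K ^ 2 * (2 * M) * η) < 1) :
    ∃ x ∈ closedBall xbar ((1 - Real.sqrt (1 - 2 * (K ^ 2 * (2 * M) * η))) / (K * (2 * M))),
      g₀ + A x + Q x x = 0 ∧
      ∀ y ∈ closedBall xbar ((1 - Real.sqrt (1 - 2 * (K ^ 2 * (2 * M) * η))) / (K * (2 * M))),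
        g₀ + A y + Q y y = 0 → y = x :=
  existsUnique_zero_of_kantorovich (F := fun v : X => g₀ + A v + Q v v) (F' := fun w : X => A + Q w + Q.flip w)
    Φ hΦ (hasFDerivAt_quadraticMap' g₀ A Q) hK
    (fun x => norm_fderiv_quadraticMap_sub_le A Q hMpos.le hM x xbar) hη hKpos (by positivity) h

/-- Window form of `existsUnique_zero_of_kantorovich_quadratic`: uniqueness in every closed ball of radius `ρ` with
`(1 − √(1 − 2K²(2M)η))/(K·2M) ≤ ρ < 1/(K·2M)`. [cite: Deuflhard2011, §2.1.1 Thm. 2.1 (with `α ≤ Kη`, `ω̄₀ ≤ 2MK`)] -/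
theorem existsUnique_zero_of_kantorovich_quadratic_window [CompleteSpace X] (g₀ : Y) (A : X →L[ℝ] Y)
    (Q : X →L[ℝ] X →L[ℝ] Y) (xbar : X) (Φ : X ≃L[ℝ] Y) (hΦ : (Φ : X →L[ℝ] Y) = A + Q xbar + Q.flip xbar)
    {K M η ρ : ℝ} (hK : ‖(Φ.symm : Y →L[ℝ] X)‖ ≤ K) (hM : ∀ u v, ‖Q u v‖ ≤ M * ‖u‖ * ‖v‖)
    (hη : ‖g₀ + A xbar + Q xbar xbar‖ ≤ η) (hKpos : 0 < K) (hMpos : 0 < M)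
    (h : 2 * (K ^ 2 * (2 * M) * η) < 1)
    (hρmin : (1 - Real.sqrt (1 - 2 * (K ^ 2 * (2 * M) * η))) / (K * (2 * M)) ≤ ρ) (hρmax : ρ < 1 / (K * (2 * M))) :
    ∃ x ∈ closedBall xbar ρ, g₀ + A x + Q x x = 0 ∧ ∀ y ∈ closedBall xbar ρ, g₀ + A y + Q y y = 0 → y = x :=
  existsUnique_zero_of_kantorovich_window (F := fun v : X => g₀ + A v + Q v v)
    (F' := fun w : X => A + Q w + Q.flip w) Φ hΦ (hasFDerivAt_quadraticMap' g₀ A Q) hK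
    (fun x => norm_fderiv_quadraticMap_sub_le A Q hMpos.le hM x xbar) hη hKpos (by positivity) h hρmin hρmax

end Literature.Analysis.Calculus

end
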